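import Mathlib
import Literature.Computability.Complexity.KRWComposition
import Summits.PneNP.PneNP.Theses.KrwChromaticSteering

/-! Sketch for the crux idea card `separable-steering-entropy` (stmt-PneNP-18538).  SELF-CONTAINED copy of the
two protocol-class definitions of the published tree file `Cruxes/StrongComposition/LensNegationP5g17.lean`
(namespace `…Cruxes.StrongComposition.LabelPublic`, where the First lemma is PROVED as
`exists_solves_of_labelPublic` and the bounded-type rung as `typedSep_rect_bound`), so that this sketch elaborates
even while the farm has not yet built that module.  Statements only; no proofs claimed here except the
restriction sanity lemma. -/

set_option linter.dupNamespace false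

namespace Summit.PneNP.PneNP.Cruxes.StrongComposition.LabelPublic.SketchG17

open Literature.Computability.Complexity

variable {m n : ℕ}

/-- (copy) label-public separable protocol trees. -/
def LabelPublic (g : (Fin n → Bool) → Bool) : KWTree (Fin m × Fin n) → Prop
  | .leaf _ => True
  | .alice s P Q =>
      ((∃ φ : (Fin m → Bool) → Bool, ∀ X, s X = φ (rowLabels g X)) ∨
        (∃ (i : Fin m) (ψ : (Fin n → Bool) → Bool), ∀ X, s X = ψ (row X i))) ∧
      LabelPublic g P ∧ LabelPublic g Q
  | .bob s P Q =>
      ((∃ φ : (Fin m → Bool) → Bool, ∀ Y, s Y = φ (rowLabels g Y)) ∨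
        (∃ (i : Fin m) (ψ : (Fin n → Bool) → Bool), ∀ Y, s Y = ψ (row Y i))) ∧
      LabelPublic g P ∧ LabelPublic g Q

/-- (copy) `K`-typed separable protocol trees (label-private single-row steering through `K` types). -/
def TypedSep (g : (Fin n → Bool) → Bool) {K : ℕ} (τA τB : (Fin m → Bool) → Fin K) :
    KWTree (Fin m × Fin n) → Prop
  | .leaf _ => True
  | .alice s P Q =>
      ((∃ φ : (Fin m → Bool) → Bool, ∀ X, s X = φ (rowLabels g X)) ∨
        (∃ (ι : Fin K → Fin m) (ψ : Fin K → (Fin n → Bool) → Bool),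
          ∀ X, s X = ψ (τA (rowLabels g X)) (row X (ι (τA (rowLabels g X)))))) ∧
      TypedSep g τA τB P ∧ TypedSep g τA τB Q
  | .bob s P Q =>
      ((∃ φ : (Fin m → Bool) → Bool, ∀ Y, s Y = φ (rowLabels g Y)) ∨
        (∃ (ι : Fin K → Fin m) (ψ : Fin K → (Fin n → Bool) → Bool),
          ∀ Y, s Y = ψ (τB (rowLabels g Y)) (row Y (ι (τB (rowLabels g Y)))))) ∧
      TypedSep g τA τB P ∧ TypedSep g τA τB Q

/-- FIRST LEMMA of the line, as a signature (PROVED in the tree file as `exists_solves_of_labelPublic`). -/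
def FirstLemma : Prop :=
  ∀ (m n : ℕ) (f : (Fin m → Bool) → Bool) (g : (Fin n → Bool) → Bool),
    (∃ a b, f a ≠ f b) → (∃ x y, g x ≠ g y) →
    ∀ P : KWTree (Fin m × Fin n), LabelPublic g P → P.SolvesStrong f g →
    ∀ dg : ℕ, (∀ R : KWTree (Fin n), R.Solves g → dg ≤ R.depth) →
      ∃ Q : KWTree (Fin m), Q.Solves f ∧ Q.depth + dg ≤ P.depth + 2

/-- NEXT RUNG (open; residue R1): C1 restricted to SINGLE-ROW protocols with ARBITRARY private steering
(`TypedSep` with no bound on `K`).  The tree theorem `typedSep_rect_bound` is its bounded-`K` case. -/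
def SingleRowComposition : Prop :=
  ∃ c : ℕ, ∀ m n : ℕ, 1 ≤ n → ∀ f : (Fin m → Bool) → Bool, (∃ a b, f a ≠ f b) →
    ∃ g : (Fin n → Bool) → Bool, ∀ (K : ℕ) (τA τB : (Fin m → Bool) → Fin K)
      (P : KWTree (Fin m × Fin n)), TypedSep g τA τB P → P.SolvesStrong f g →
        ∃ Q : KWTree (Fin m), Q.Solves f ∧ Q.depth + n ≤ P.depth + c * (Nat.log 2 (m * n) + 1)

/-- Sanity: the rung is a RESTRICTION of the crux (C1 ⇒ rung), not a costume of it. -/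
theorem singleRowComposition_of_strongComposition
    (h : Summit.PneNP.PneNP.Theses.KrwChromaticSteering.StrongComposition) : SingleRowComposition := by
  obtain ⟨c, hc⟩ := h
  refine ⟨c, fun m n hn f hf => ?_⟩
  obtain ⟨g, hg⟩ := hc m n hn f hf
  exact ⟨g, fun K τA τB P _ hP => hg P hP⟩

end Summit.PneNP.PneNP.Cruxes.StrongComposition.LabelPublic.SketchG17
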